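import Mathlib.NumberTheory.ArithmeticFunction.Liouville
import Literature.Barriers.Parity.SiegelZeroPrimePairs
import Literature.NumberTheory.Sieve.SingularSeriesProofs
import Literature.NumberTheory.Sieve.LinearEquationsInPrimesWTrick
import Literature.NumberTheory.Sieve.ParityBarrier
import Literature.NumberTheory.Sieve.ParityWave0
import Literature.NumberTheory.LFunctions.RHWave0
import HarnessLib
import HarnessLib.Audit

/-!
# Barrier catalogue `Parity`: the Siegel-zero dichotomy — exceptional zeros of unbounded quality
# imply the twin prime conjecture (Heath-Brown 1983), so a disproof must bound Siegel zeros;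
# and the Liouville side (Tao–Teräväinen 2022)

Catalogue entry (D-0021) for the summit `Parity`, sub-problem `GeneralizedHardyLittlewood`
(seed "Siegel-zero / exceptional-character obstructions"). It COMPLEMENTS and imports the tree
entry `Literature/Barriers/Parity/SiegelZeroPrimePairs.lean` (sub-problem `BatemanHorn`:
`Literature.Barriers.Parity.SiegelZeroPrimePairBarrier` = Goldston–Suriajaya, shift-UNIFORM pair bounds repel
exceptional zeros; `Literature.Barriers.Parity.MatomakiMerikoski2023_fixedShift` = the fixed-shift
Hardy–Littlewood asymptotic IN THE PRESENCE of an exceptional zero). Nothing there is restated.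

The catalogued declaration is `SiegelZeroTwinPrimes` (docstring = BARRIER block): Heath-Brown's
dichotomy in the quality form supported by the sources — Siegel zeros (Tao–Teräväinen,
Definition 1.4) of UNBOUNDED quality `η` at arbitrarily large conductors imply the twin prime
conjecture `Literature.NumberTheory.Sieve.TwinPrimeConjecture`. It is PROVED here modulo the vendored
Matomäki–Merikoski theorem (`SiegelZeroTwinPrimes_of_matomakiMerikoski`): if twin primes are
finite, `∑_{n ≤ X} Λ(n)Λ(n+2) = o(X)` (only higher prime powers survive,
`Literature.NumberTheory.Sieve.card_higherPrimePowers_le`), while at a Siegel zero of quality `η` and conductor `q` the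
Matomäki–Merikoski asymptotic pins the sum at `X = q^{10}` to `𝔖_2 X (1 + O(e^{-√log η}))`,
`𝔖_2 = 2C₂ > 0` (`Literature.NumberTheory.Sieve.twinPrimeConst_pos_holds`). Consequently
(`SiegelZeroTwinPrimes.disproof_bounds_quality`, proved) a DISPROOF of the twin-prime case of
`GeneralizedHardyLittlewood` is a proof that the quality of Siegel zeros is bounded at large
conductors — an effective Siegel-type zero-free region, which is not known. The Liouville side —
Tao–Teräväinen's Corollary 1.8 (ii), Chowla's conjecture on the scales attached to an exceptional
zero — is vendored as the named fact `TaoTeravainen2021_chowla`, with the analogous proved no-go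
`robustChowlaFailure_eliminates` stated on the tree's `Literature.NumberTheory.Sieve.liouvilleCorrelation`
(the object of `Literature.NumberTheory.Sieve.ChowlaConjecture`).

## What the sources print (verified on the page; arXiv page numbers)

* Tao–Teräväinen, *The Hardy–Littlewood–Chowla conjecture in the presence of a Siegel zero*,
  J. London Math. Soc. 106 (2022), arXiv:2109.06291
  [cite: TaoTeravainen2021, Definition 1.4, Theorem 1.5, Corollary 1.8, §1.2, §2.1].
  Definition 1.4: "A Siegel zero `β` is a real number associated to a primitive quadratic
  Dirichlet character `χ` of conductor `q_χ` such that `L(β,χ) = 0` and `β = 1 - 1/(η log q_χ)`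
  for some `η ≥ 10` (which we call the quality of the zero)." (1.4): "From Siegel's theorem we
  have the (ineffective) upper bound `η ≪_ε q_χ^ε`". Theorem 1.5 (i) [Heath-Brown]: for distinct
  fixed `h₁, h₂`, `𝔼_{n ≤ x} Λ(n+h₁)Λ(n+h₂) = 𝔖 + O(1/log log η)` uniformly for
  `q_χ^{250} ≤ x ≤ q_χ^{300}` — so twin primes follow from zeros of UNBOUNDED quality.
  Corollary 1.8 (ii): "For any distinct fixed natural numbers `h'₁, …, h'_ℓ`, one has
  `𝔼_{n ≤ x} λ(n+h'₁)⋯λ(n+h'_ℓ) ≪ 1/log^{1/10} η` for `q_χ^{1/2+ε₀} ≤ x ≤ q_χ^{η^{1/2}}`"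
  (`0 < ε₀ < 1` fixed; §2.1: the implied constants may depend on `ℓ, h'ⱼ, ε₀`, "we permit the
  constants to be ineffective", "We will also assume that `η` is sufficiently large depending on
  the fixed quantities, since otherwise the claim follows from standard upper bound sieves").
  §1.1: "Only the `k + ℓ ≤ 1` cases of Conjecture 1.3 are currently known, even if one assumes
  the generalized Riemann hypothesis"; "some progress on this conjecture can be made under an
  opposing hypothesis, namely the existence of a Siegel zero." §1.2: "`λ` "pretends" to be like
  the Dirichlet character `χ`, and the von Mangoldt function `Λ = μ * log` similarly "pretends"
  to be like `χ * log`"; "Now that all terms in the correlation have been replaced with tractable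
  Type I sums".
* Matomäki–Merikoski, IMRN 2023, Corollary 1.1 (i) — the tree's
  `Literature.Barriers.Parity.MatomakiMerikoski2023_fixedShift` (`|∑_{n ≤ X} Λ(n)Λ(n+h) - X𝔖_h| ≤ K X e^{-C√log η}`
  for `X ∈ [q^{10}, q^{10 log η}]`), read in the imported entry, whose §1 also reports
  Heath-Brown's range `X ∈ [q^{250}, q^{500}]` and error `O_h(X/log log η)`
  [cite: MatomakiMerikoski2023, Corollary 1.1(i) and §1].
* Heath-Brown, *Prime twins and Siegel zeros*, Proc. London Math. Soc. 47 (1983), 193–224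
  [cite: Heathbrown1983, main theorem (as reported in Tao–Teräväinen 2022, Theorem 1.5(i), and Matomäki–Merikoski 2023, §1)] — primary source of the dichotomy, read here only through the reports in
  Tao–Teräväinen (Theorem 1.5 (i)) and Matomäki–Merikoski (§1); acquisition request acq-00505.
* Wright, *Prime tuples and Siegel zeros*, Bull. London Math. Soc. 56 (2023), arXiv:2111.14054, §2
  [cite: Wright2023PrimeTuplesSiegel, §2]: restates Heath-Brown as "Let `χ_q` be a character mod
  `q`, and let `β` be such that `L(β, χ_q) = 0` with `β > 1 - 1/(3 log q)`. If there are infinitely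
  many `χ_q` for which such a `β` exists then there are infinitely many twin primes" — a form with
  BOUNDED quality (`η > 3`) that the error terms `O(1/log log η)` do not support; it is quoted, not
  transcribed (scope caveat (c)). Abstract: under infinitely many Siegel zeros, prime `m`-tuples
  `≪ e^{1.9828 m}` apart.
* Tao, *Heuristic limitations of the circle method* (blog, 2012), §4
  [cite: Tao2012CircleMethodBlog, §4]: "about the only thing which is strong enough to rule out a
  conspiracy is a conflicting conspiracy … Heath-Brown's result that the existence of a Siegel zero
  … implies the truth of the twin prime conjecture (basically by upending all the previous
  heuristics, and causing the major arc sums to dominate the minor arcs instead of vice versa). But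
  since we do not expect any conspiracies to occur amongst the primes, one cannot directly use
  these sorts of "dueling conspiracies" methods to unilaterally rule out any given conspiracy."

## Conventions

A Siegel zero of quality `η` attached to `χ mod q` is `IsSiegelZero χ η` (primitive, quadratic =
`MulChar.IsQuadratic`, `η ≥ 10`, `L(1 - 1/(η log q), χ) = 0` with Mathlib's
`DirichletCharacter.LFunction`) — the inline hypotheses of the imported Matomäki–Merikoski facts
except their `2 ≤ q`, which is not part of Definition 1.4 and is supplied where needed through the
conductor threshold `q₀` of `UnboundedSiegelZeros` (at `q = 1` the last clause reads `ζ(1) = 0` in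
Mathlib's junk-value convention and is refutable, so nothing is gained or lost). The negation
`¬UnboundedSiegelZeros` — bounded quality at large conductors — is implied by the tree's open
no-Siegel-zero statement `Literature.NumberTheory.LFunctions.NoSiegelZeros` (rh.S34; `not_unboundedSiegelZeros_of_noSiegelZeros`,
proved), so the no-go theorems below say that a disproof of the twin prime conjecture proves this
large-conductor weakening of rh.S34. `𝔼_{n ≤ x}` is the average over `1 ≤ n ≤ x`, `x ∈ ℕ` (a specialisation of the real `x` of
the source); shifts are natural numbers `≥ 1` as printed; `𝔖_h` = `Literature.goldbachSingularSeries h`.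

## `UnboundedSiegelZeros` is a registered OPEN statement, not literature debt

The tenured prove-seat returned `open-problem` for `UnboundedSiegelZeros`; re-read on the page
(arXiv:2109.06291: Abstract, §1.1, Definition 1.4, (1.4), Theorem 1.5) the verdict stands. The
source ARGUES UNDER the existence of Siegel zeros — "Assuming that Siegel zeros exist" (Abstract),
"some progress on this conjecture can be made under an opposing hypothesis, namely the existence
of a Siegel zero" (§1.1), "Suppose that one has a Siegel zero `β` with associated conductor `q_χ`
and quality `η`" (Theorem 1.5) — and proves nothing about that hypothesis beyond quoting Siegel's
ineffective `η ≪_ε q_χ^ε` ((1.4)) [cite: TaoTeravainen2021, Abstract, §1.1, (1.4) and Theorem 1.5];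
the tree refutes it from GRH (`not_unboundedSiegelZeros_of_generalizedRiemannHypothesis`,
companion file `SiegelZeroDichotomyProofs.lean`) and from rh.S34
(`not_unboundedSiegelZeros_of_noSiegelZeros`, below), both of which are open. The docstring of
`UnboundedSiegelZeros` therefore begins `OPEN CONJECTURE —`, cites where the hypothesis is posed
and carries `[status: open]` (CONVENTIONS §4); there is deliberately no `UnboundedSiegelZeros_holds`
to expect. The NAME IS KEPT (not `…Conjecture`): it is the antecedent of the record
`SiegelZeroTwinPrimes` and of the no-go theorems here, and it is used in
`SiegelZeroDichotomyProofs.lean`, `SiegelZeroDichotomyHolds.lean` and in Theses docstrings and idea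
cards of the summit `Parity`. No statement, definition body or theorem of this file was changed.
-/

noncomputable section

open Filter Finset
open scoped ArithmeticFunction.vonMangoldt Topology

namespace Literature.Barriers.Parity

/-! ### Siegel zeros -/

/-- **Siegel zero of quality `η`** attached to `χ mod q` (Tao–Teräväinen, Definition 1.4; cf. the
inline hypotheses of `Literature.Barriers.Parity.MatomakiMerikoski2023_fixedShift`, which additionally carry
`2 ≤ q`): `χ` primitive and quadratic, `η ≥ 10`, and `L(1 - 1/(η log q), χ) = 0`. [cite: TaoTeravainen2021, Definition 1.4] -/
def IsSiegelZero {q : ℕ} [NeZero q] (χ : DirichletCharacter ℂ q) (η : ℝ) : Prop :=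
  χ.IsPrimitive ∧ χ.IsQuadratic ∧ 10 ≤ η ∧ χ.LFunction ((1 - 1 / (η * Real.log q) : ℝ) : ℂ) = 0

/-- The quality of a Siegel zero is `≥ 10` by definition. [cite: TaoTeravainen2021, Definition 1.4] -/
theorem IsSiegelZero.ten_le {q : ℕ} [NeZero q] {χ : DirichletCharacter ℂ q} {η : ℝ}
    (h : IsSiegelZero χ η) : 10 ≤ η := h.2.2.1

/-- OPEN CONJECTURE — **Siegel zeros of unbounded quality exist** (the standing HYPOTHESIS
"Siegel zeros exist" of Heath-Brown's dichotomy, in the form supported by Theorem 1.5 (i)): for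
every `η₀` and `q₀` there is a Siegel zero (Definition 1.4: `χ` primitive quadratic mod `q`,
`L(1 - 1/(η log q), χ) = 0`, quality `η ≥ 10`) of quality `η ≥ η₀` attached to a conductor
`q ≥ q₀`. POSED — as a hypothesis to argue under, never as a result — in T. Tao, J. Teräväinen,
*The Hardy–Littlewood–Chowla conjecture in the presence of a Siegel zero*, J. London Math. Soc.
(2) 106 (2022), arXiv:2109.06291: Abstract "Assuming that Siegel zeros exist, we prove a hybrid
version of the Chowla and Hardy–Littlewood prime tuples conjectures"; §1.1 (the paragraph before
Definition 1.4) "it turns out (perhaps surprisingly) that some progress on this conjecture can be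
made under an opposing hypothesis, namely the existence of a Siegel zero"; Theorem 1.5 "Suppose
that one has a Siegel zero `β` with associated conductor `q_χ` and quality `η`", whose part (i) is
Heath-Brown's *Prime twins and Siegel zeros* (1983) "[11, Theorem 1]" with error term
`O(1/log log η)` — informative only as `η → ∞`, i.e. for zeros of UNBOUNDED quality at
arbitrarily large conductors, which is the statement below
[cite: TaoTeravainen2021, Abstract, §1.1 (before Definition 1.4), Definition 1.4 and Theorem 1.5 (i)].
Standing: proved nowhere and expected to be FALSE — it is the negation of a consequence of the
Generalised Riemann Hypothesis (companion file `SiegelZeroDichotomyProofs.lean`,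
`not_unboundedSiegelZeros_of_generalizedRiemannHypothesis`; the rh.S34 version
`not_unboundedSiegelZeros_of_noSiegelZeros` is proved below), while its negation — a bound
`η < η₀` on the quality of every Siegel zero at conductors `q ≥ q₀`, an effective Siegel-type
zero-free interval (`not_unboundedSiegelZeros_iff`, `not_unboundedSiegelZeros_iff_zeroFree` in the
companion file) — is open as well: "From Siegel's theorem we have the (ineffective) upper bound
`η ≪_ε q_χ^ε` on the quality of a Siegel zero for any `ε > 0`" is all that is printed
[cite: TaoTeravainen2021, (1.4)]. A registered OPEN statement (CONVENTIONS §4), not literature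
debt: there is deliberately no `UnboundedSiegelZeros_holds`; the statement is used only as the
antecedent of the record `SiegelZeroTwinPrimes := UnboundedSiegelZeros → TwinPrimeConjecture` and,
negated, as the conclusion of the no-go theorems. The name is kept (not `…Conjecture`) because
`SiegelZeroTwinPrimes`, `SiegelZeroDichotomyProofs.lean`, `SiegelZeroDichotomyHolds.lean` and
several Theses docstrings and idea cards of the summit `Parity` refer to it. [status: open] -/
@[conjecture] def UnboundedSiegelZeros : Prop :=
  ∀ (η₀ : ℝ) (q₀ : ℕ), ∃ (q : ℕ) (_ : NeZero q) (χ : DirichletCharacter ℂ q) (η : ℝ),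
    q₀ ≤ q ∧ η₀ ≤ η ∧ IsSiegelZero χ η

/-- The tree's open no-Siegel-zero statement `Literature.NumberTheory.LFunctions.NoSiegelZeros` (rh.S34: some `c > 0` such that
`L(σ, χ) ≠ 0` for `σ > 1 - c/log q`, every real primitive `χ mod q`, `q ≥ 3`) bounds the quality of
every Siegel zero by `1/c` at every conductor `q ≥ 3`, hence refutes `UnboundedSiegelZeros`; so
`¬UnboundedSiegelZeros` (bounded quality at LARGE conductors) is a weakening of rh.S34, and it is
this weakening that the no-go theorems below extract from a disproof. [folklore] -/
theorem not_unboundedSiegelZeros_of_noSiegelZeros (h : Literature.NumberTheory.LFunctions.NoSiegelZeros) : ¬ UnboundedSiegelZeros := by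
  obtain ⟨c, hc, hzero⟩ := h
  intro hU
  obtain ⟨q, hq0, χ, η, hq, hη, hprim, hquad, h10, hL⟩ := hU (1 / c + 1) 3
  have hq1 : (1 : ℝ) < q := by exact_mod_cast (show 1 < q by omega)
  have hlog : 0 < Real.log q := Real.log_pos hq1
  have hcη : 1 < c * η := by
    have h1 : 1 / c < η := by linarith
    have h2 := (div_lt_iff₀ hc).1 h1
    linarith [mul_comm η c]
  have hσ : 1 - c / Real.log q < 1 - 1 / (η * Real.log q) := by
    have hη0 : 0 < η := by linarith
    have h3 : 1 / (η * Real.log q) < c / Real.log q := by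
      rw [div_lt_div_iff₀ (by positivity) hlog]
      nlinarith
    linarith
  exact hzero q hq χ hquad hprim _ hσ hL

/-! ### The barrier record -/

/-- **Barrier: the Siegel-zero dichotomy — Siegel zeros of unbounded quality imply the twin prime
conjecture (Heath-Brown 1983, in the quality form of Tao–Teräväinen Theorem 1.5 (i) and
Matomäki–Merikoski Corollary 1.1).** "[Heath-Brown] For any distinct fixed natural numbers
`h₁, h₂`, one has `𝔼_{n ≤ x} Λ(n+h₁)Λ(n+h₂) = 𝔖 + O(1/log log η)` uniformly for all
`q_χ^{250} ≤ x ≤ q_χ^{300}`", whence prime twins from zeros of unbounded quality `η`. Rendered as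
`UnboundedSiegelZeros → Literature.Parity.TwinPrimeConjecture` and PROVED modulo the vendored
Matomäki–Merikoski theorem (`SiegelZeroTwinPrimes_of_matomakiMerikoski`); kept as a `def` so that
the no-go `SiegelZeroTwinPrimes.disproof_bounds_quality` can take it as a hypothesis.
[cite: TaoTeravainen2021, Theorem 1.5 (i)] [cite: MatomakiMerikoski2023, Corollary 1.1(i) and §1 (report on Heath-Brown 1983)] [cite: Heathbrown1983, main theorem (as reported in Tao–Teräväinen 2022, Theorem 1.5(i), and Matomäki–Merikoski 2023, §1)]

BARRIER (D-0021; one line per key):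
technique_class: siegel-zero-agnostic-disproofs exceptional-character dueling-conspiracies — (A) arguments meant to REFUTE the twin-prime case `(n, n + 2)` of `GeneralizedHardyLittlewood` (`Literature.NumberTheory.Sieve.TwinPrimeConjecture`), or Chowla's conjecture `Literature.NumberTheory.Sieve.ChowlaConjecture` robustly (`|∑_{n < x} λ(n+h₁)⋯λ(n+h_k)| ≥ cx` for all large `x`), by methods that do not bound the quality of Siegel zeros (`UnboundedSiegelZeros` left open); (B) for PROOFS, the "dueling conspiracies" strategy of extracting prime pairs from an assumed exceptional zero [cite: TaoTeravainen2021, Theorem 1.5 (i) and Corollary 1.8] [cite: Tao2012CircleMethodBlog, §4].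
blocks: (A) every disproof of the twin prime conjecture is ipso facto a proof that Siegel zeros have bounded quality at large conductors, `∃ η₀ q₀ ∀ q ≥ q₀: L(σ, χ) ≠ 0` for `σ = 1 - 1/(η log q)`, `η ≥ η₀`, `χ` primitive quadratic mod `q` (`SiegelZeroTwinPrimes.disproof_bounds_quality`, proved; unconditional modulo the tree's `MatomakiMerikoski2023_fixedShift`), — the large-conductor form of the tree's open `Literature.NumberTheory.LFunctions.NoSiegelZeros` (rh.S34; `not_unboundedSiegelZeros_of_noSiegelZeros`) — whereas only "the (ineffective) upper bound `η ≪_ε q_χ^ε`" is known [cite: TaoTeravainen2021, (1.4)] [cite: MatomakiMerikoski2023, Corollary 1.1(i)]; the same for a robust disproof of Chowla's conjecture for one tuple of shifts `≥ 1` (`robustChowlaFailure_eliminates`, proved from `TaoTeravainen2021_chowla`) [cite: TaoTeravainen2021, Corollary 1.8 (ii)]; (B) as a route TO twin primes the mechanism is unusable unconditionally: "one cannot directly use these sorts of "dueling conspiracies" methods to unilaterally rule out any given conspiracy" [cite: Tao2012CircleMethodBlog, §4], and the complementary branch is empty-handed: "Only the `k + ℓ ≤ 1` cases of Conjecture 1.3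 are currently known, even if one assumes the generalized Riemann hypothesis" [cite: TaoTeravainen2021, §1.1].
because: with an exceptional zero of quality `η`, `χ(p) = -1` for most primes `p` comparable to `q_χ` in logarithmic scale, so "`λ` "pretends" to be like the Dirichlet character `χ`, and the von Mangoldt function `Λ = μ * log` similarly "pretends" to be like `χ * log`"; replacing `Λ` by `Λ_Siegel = (χ * log)·ν` (a Selberg-sieve weight) and `λ` by `λ_Siegel`, then both by Type I truncations, turns the binary correlation into "tractable Type I sums" (a character-twisted divisor correlation, controlled by Weil bounds) which evaluate to `𝔖 + o(1)` — the parity obstruction is void once `λ` itself is Type-I-accessible [cite: TaoTeravainen2021, §1.2 (steps (i)–(v))]; heuristically the exceptional zero is "causing the major arc sums to dominate the minor arcs instead of vice versa" [cite: Tao2012CircleMethodBlog, §4]; formally: without twin primes above `n₀` the pair sum is `≤ n₀ log²(n₀+2) + 2(√(X+2)+1)(log₂(X+2)+1) log²(X+2) = o(X)` (`pairSum_le_of_noTwinAbove`), against `≥ 𝔖_2 X - K X e^{-√log η}` at `X = q^{10}` for a Siegel zero of quality `η` (tree fact), `𝔖_2 = 2C₂ > 0` (`goldbachSingularSeries_two`,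 `Literature.NumberTheory.Sieve.twinPrimeConst_pos_holds`).
evasions_known: none that settle the binary case; what IS available is conditional on the exceptional zero — the fixed-shift pair asymptotic on `[q^{10}, q^{10 log η}]` and `[q^{10 log η}, q^{η^{1-ε}}]` (tree: `MatomakiMerikoski2023_fixedShift`, `_fixedShift_ii`) [cite: MatomakiMerikoski2023, Corollary 1.1], Hardy–Littlewood–Chowla for `k ≤ 2` von Mangoldt factors on `q_χ^{10k+1/2+ε₀} ≤ x ≤ q_χ^{η^{1/2}}` [cite: TaoTeravainen2021, Theorem 1.6], prime `m`-tuples `≪ e^{1.9828 m}` apart [cite: Wright2023PrimeTuplesSiegel, Abstract], Sarnak's conjecture at infinitely many scales (Chinis) [cite: TaoTeravainen2021, Corollary 1.8 (ii) and the paragraph after it]; conversely SHIFT-UNIFORM upper bounds would repel exceptional zeros (tree: `Literature.Barriers.Parity.SiegelZeroPrimePairBarrier`, `GoldstonSuriajaya2021_goldbach`) [cite: GoldstonSuriajaya2021, Theorems 1, 2].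
scope_caveats: (a) only disproofs in the strict sense (finitely many twin primes), resp. ROBUST eventual failures of Chowla (relative size `c > 0` for all large `x`), are shown to bound Siegel zeros; a failure of the Hardy–Littlewood ASYMPTOTIC with infinitely many twin primes, or a Chowla failure along a subsequence / of size `o(1)`, is not addressed [cite: TaoTeravainen2021, Corollary 1.8]; (b) the conclusion is a bound on the QUALITY of Siegel zeros at large conductors (`η < η₀` for `q ≥ q₀`), not their non-existence, and the constants are ineffective as in the sources [cite: TaoTeravainen2021, §2.1]; (c) Heath-Brown's theorem is rendered in the quality form of Theorem 1.5 (i) (zeros of unbounded quality, primitive quadratic characters); Wright's restatement with the fixed threshold `β > 1 - 1/(3 log q)` for "a character mod `q`" is NOT transcribed, and Heath-Brown's own text (Theorem numbering, admissible constants) was not read [cite: Wright2023PrimeTuplesSiegel, §2] [cite: Heathbrown1983, main theorem (as reported in Tao–Teräväinen 2022, Theorem 1.5(i), and Matomäki–Merikoski 2023, §1)]; (d) Goldbach `(n, N - n)` and general binary systems of `GeneralizedHardyLittlewood` are not treated here ("One could also generalize this conjecture by replacing the forms … but we do not do so here") [cite: TaoTeravainen2021, §1.1 (after Conjecture 1.3)]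 — for Goldbach-type shift-uniform bounds see the imported entry.
status: established — PROVED here modulo the vendored theorem of Matomäki–Merikoski (`SiegelZeroTwinPrimes_of_matomakiMerikoski`); the Liouville side is the named fact `TaoTeravainen2021_chowla` [cite: MatomakiMerikoski2023, Corollary 1.1(i)] [cite: TaoTeravainen2021, Corollary 1.8]
-/
def SiegelZeroTwinPrimes : Prop :=
  UnboundedSiegelZeros → Literature.NumberTheory.Sieve.TwinPrimeConjecture

/-- **The no-go for disproofs** (proved from the record): if the twin prime conjecture is false,
the quality of Siegel zeros is bounded at large conductors — there are `η₀`, `q₀` such that every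
Siegel zero attached to a conductor `q ≥ q₀` has quality `η < η₀`, i.e. `L(1 - 1/(η log q), χ) ≠ 0`
for `η ≥ η₀`, `q ≥ q₀`, `χ` primitive quadratic. [cite: TaoTeravainen2021, Theorem 1.5 (i) and (1.4)] -/
theorem SiegelZeroTwinPrimes.disproof_bounds_quality (h : SiegelZeroTwinPrimes)
    (hno : ¬ Literature.NumberTheory.Sieve.TwinPrimeConjecture) :
    ∃ η₀ : ℝ, ∃ q₀ : ℕ, ∀ (q : ℕ) [NeZero q] (χ : DirichletCharacter ℂ q) (η : ℝ),
      q₀ ≤ q → IsSiegelZero χ η → η < η₀ := by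
  have hnot : ¬ UnboundedSiegelZeros := fun hsz => hno (h hsz)
  unfold UnboundedSiegelZeros at hnot
  simp only [not_forall, not_exists, not_and] at hnot
  obtain ⟨η₀, q₀, hη⟩ := hnot
  refine ⟨η₀, q₀, fun q inst χ η hq hS => ?_⟩
  by_contra hlt
  exact hη q inst χ η hq (not_lt.mp hlt) hS
/-- `𝔖_2 = 2C₂` (the Hardy–Littlewood twin constant of the shift `h = 2` in the normalisation
`Literature.NumberTheory.Sieve.goldbachSingularSeries`). [folklore] -/
theorem goldbachSingularSeries_two : Literature.NumberTheory.Sieve.goldbachSingularSeries 2 = 2 * Literature.NumberTheory.Sieve.twinPrimeConst := by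
  rw [Literature.NumberTheory.Sieve.goldbachSingularSeries, if_neg (by decide), Nat.Prime.primeFactors Nat.prime_two,
    Finset.filter_singleton, if_neg (lt_irrefl 2), Finset.prod_empty, mul_one]

/-- If there is no twin prime pair above `n₀`, the `Λ`-weighted pair sum up to `N` is carried by
the twin primes `≤ n₀` and by the higher prime powers (`Literature.NumberTheory.Sieve.card_higherPrimePowers_le`):
`∑_{m ≤ N} Λ(m)Λ(m+2) ≤ n₀ log²(n₀+2) + 2 (√(N+2)+1)(log₂(N+2)+1) log²(N+2)`. [folklore] -/
theorem pairSum_le_of_noTwinAbove {n₀ : ℕ} (hno : ∀ p : ℕ, n₀ < p → ¬ (p.Prime ∧ (p + 2).Prime))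
    (N : ℕ) :
    ∑ m ∈ Icc 1 N, Λ m * Λ (m + 2) ≤
      (n₀ : ℝ) * Real.log ((n₀ : ℝ) + 2) ^ 2 +
        2 * (((Nat.sqrt (N + 2) + 1) * (Nat.log 2 (N + 2) + 1) : ℕ) : ℝ) *
          Real.log ((N : ℝ) + 2) ^ 2 := by
  classical
  set L₀ : ℝ := Real.log ((n₀ : ℝ) + 2) ^ 2 with hL₀_def
  set L₁ : ℝ := Real.log ((N : ℝ) + 2) ^ 2 with hL₁_def
  set A := (Icc 1 N).filter fun m => m.Prime ∧ (m + 2).Prime with hA_def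
  set B := (Icc 1 N).filter fun m =>
      (IsPrimePow m ∧ ¬ m.Prime) ∨ (IsPrimePow (m + 2) ∧ ¬ (m + 2).Prime) with hB_def
  have hL₀ : 0 ≤ L₀ := sq_nonneg _
  have hL₁ : 0 ≤ L₁ := sq_nonneg _
  -- termwise bound
  have hterm : ∀ m ∈ Icc 1 N, Λ m * Λ (m + 2) ≤
      (if m ∈ A then L₀ else 0) + (if m ∈ B then L₁ else 0) := by
    intro m hm
    have hmN : m ≤ N := (mem_Icc.mp hm).2
    have hm1 : 1 ≤ m := (mem_Icc.mp hm).1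
    have hA0 : (0 : ℝ) ≤ (if m ∈ A then L₀ else 0) := by split_ifs <;> simp [hL₀]
    have hB0 : (0 : ℝ) ≤ (if m ∈ B then L₁ else 0) := by split_ifs <;> simp [hL₁]
    have h0m : 0 ≤ Λ m := ArithmeticFunction.vonMangoldt_nonneg
    have h0m2 : 0 ≤ Λ (m + 2) := ArithmeticFunction.vonMangoldt_nonneg
    have hlogm : Λ m ≤ Real.log m := ArithmeticFunction.vonMangoldt_le_log
    have hlogm2 : Λ (m + 2) ≤ Real.log ((m : ℝ) + 2) := by
      have := ArithmeticFunction.vonMangoldt_le_log (n := m + 2)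
      push_cast at this
      exact this
    have hm0 : (1 : ℝ) ≤ m := by exact_mod_cast hm1
    have hlog0 : 0 ≤ Real.log m := Real.log_nonneg hm0
    by_cases h1 : IsPrimePow m
    · by_cases h2 : IsPrimePow (m + 2)
      · by_cases hp : m.Prime ∧ (m + 2).Prime
        · -- a twin pair, hence `m ≤ n₀`
          have hmn : m ≤ n₀ := by
            by_contra h
            exact hno m (not_le.mp h) hp
          have hAm : m ∈ A := mem_filter.mpr ⟨hm, hp⟩
          rw [if_pos hAm]
          have hmn' : (m : ℝ) ≤ n₀ := by exact_mod_cast hmn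
          have hb : Λ m * Λ (m + 2) ≤ L₀ := by
            calc Λ m * Λ (m + 2) ≤ Real.log m * Real.log ((m : ℝ) + 2) :=
                  mul_le_mul hlogm hlogm2 h0m2 hlog0
              _ ≤ Real.log ((n₀ : ℝ) + 2) * Real.log ((n₀ : ℝ) + 2) := by
                  apply mul_le_mul
                  · exact Real.log_le_log (by linarith) (by linarith)
                  · exact Real.log_le_log (by linarith) (by linarith)
                  · exact Real.log_nonneg (by linarith)
                  · exact Real.log_nonneg (by linarith)
              _ = L₀ := by rw [hL₀_def, sq]
          linarith
        · -- one of `m`, `m + 2` is a higher prime power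
          have hBm : m ∈ B := by
            refine mem_filter.mpr ⟨hm, ?_⟩
            by_cases hpm : m.Prime
            · exact Or.inr ⟨h2, fun h => hp ⟨hpm, h⟩⟩
            · exact Or.inl ⟨h1, hpm⟩
          rw [if_pos hBm]
          have hmN' : (m : ℝ) ≤ N := by exact_mod_cast hmN
          have hb : Λ m * Λ (m + 2) ≤ L₁ := by
            calc Λ m * Λ (m + 2) ≤ Real.log m * Real.log ((m : ℝ) + 2) :=
                  mul_le_mul hlogm hlogm2 h0m2 hlog0
              _ ≤ Real.log ((N : ℝ) + 2) * Real.log ((N : ℝ) + 2) := by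
                  apply mul_le_mul
                  · exact Real.log_le_log (by linarith) (by linarith)
                  · exact Real.log_le_log (by linarith) (by linarith)
                  · exact Real.log_nonneg (by linarith)
                  · exact Real.log_nonneg (by linarith)
              _ = L₁ := by rw [hL₁_def, sq]
          linarith
      · rw [ArithmeticFunction.vonMangoldt_eq_zero_iff.mpr h2, mul_zero]
        linarith
    · rw [ArithmeticFunction.vonMangoldt_eq_zero_iff.mpr h1, zero_mul]
      linarith
  -- sum the termwise bound
  have hsum : ∑ m ∈ Icc 1 N, Λ m * Λ (m + 2) ≤
      ∑ m ∈ Icc 1 N, ((if m ∈ A then L₀ else 0) + (if m ∈ B then L₁ else 0)) :=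
    Finset.sum_le_sum hterm
  rw [Finset.sum_add_distrib, Finset.sum_ite_mem, Finset.sum_ite_mem,
    inter_eq_right.mpr (Finset.filter_subset _ _), inter_eq_right.mpr (Finset.filter_subset _ _),
    Finset.sum_const, Finset.sum_const, nsmul_eq_mul, nsmul_eq_mul] at hsum
  -- `#A ≤ n₀`
  have hAcard : #A ≤ n₀ := by
    calc #A ≤ #(Icc 1 n₀) := by
          refine Finset.card_le_card fun m hm => ?_
          rw [hA_def, mem_filter, mem_Icc] at hm
          rw [mem_Icc]
          refine ⟨hm.1.1, ?_⟩
          by_contra h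
          exact hno m (not_le.mp h) hm.2
      _ = n₀ := by simp
  -- `#B ≤ 2 · #(higher prime powers ≤ N + 2)`
  set H := (Finset.range (N + 2 + 1)).filter fun m => IsPrimePow m ∧ ¬ m.Prime with hH_def
  have hHcard : #H ≤ (Nat.sqrt (N + 2) + 1) * (Nat.log 2 (N + 2) + 1) :=
    Literature.NumberTheory.Sieve.card_higherPrimePowers_le (N + 2)
  have hBcard : #B ≤ 2 * #H := by
    have hB₁ : #((Icc 1 N).filter fun m => IsPrimePow m ∧ ¬ m.Prime) ≤ #H := by
      refine Finset.card_le_card fun m hm => ?_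
      rw [mem_filter, mem_Icc] at hm
      rw [hH_def, mem_filter, Finset.mem_range]
      exact ⟨by omega, hm.2⟩
    have hB₂ : #((Icc 1 N).filter fun m => IsPrimePow (m + 2) ∧ ¬ (m + 2).Prime) ≤ #H := by
      refine Finset.card_le_card_of_injOn (fun m => m + 2) (fun m hm => ?_) ?_
      · rw [Finset.mem_coe, mem_filter, mem_Icc] at hm
        rw [Finset.mem_coe, hH_def, mem_filter, Finset.mem_range]
        exact ⟨show m + 2 < N + 2 + 1 by omega, hm.2⟩
      · intro a _ b _ hab
        simpa using hab
    have hBsub : B ⊆ ((Icc 1 N).filter fun m => IsPrimePow m ∧ ¬ m.Prime) ∪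
        ((Icc 1 N).filter fun m => IsPrimePow (m + 2) ∧ ¬ (m + 2).Prime) := by
      intro m hm
      rw [hB_def, mem_filter] at hm
      rw [mem_union, mem_filter, mem_filter]
      rcases hm.2 with h | h
      · exact Or.inl ⟨hm.1, h⟩
      · exact Or.inr ⟨hm.1, h⟩
    calc #B ≤ _ := Finset.card_le_card hBsub
      _ ≤ _ := Finset.card_union_le _ _
      _ ≤ 2 * #H := by omega
  have hA' : (#A : ℝ) * L₀ ≤ n₀ * L₀ := by
    exact mul_le_mul_of_nonneg_right (by exact_mod_cast hAcard) hL₀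
  have hB' : (#B : ℝ) * L₁ ≤
      2 * (((Nat.sqrt (N + 2) + 1) * (Nat.log 2 (N + 2) + 1) : ℕ) : ℝ) * L₁ := by
    refine mul_le_mul_of_nonneg_right ?_ hL₁
    have : (#B : ℝ) ≤ 2 * (#H : ℝ) := by exact_mod_cast hBcard
    have : (#H : ℝ) ≤ (((Nat.sqrt (N + 2) + 1) * (Nat.log 2 (N + 2) + 1) : ℕ) : ℝ) := by
      exact_mod_cast hHcard
    linarith
  linarith


/-- The bound of `pairSum_le_of_noTwinAbove` is `o(X)`: for every `c > 0`, eventually in real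
`X`, at `N = ⌊X⌋`, it is `≤ c X`. [folklore] -/
theorem eventually_pairSumBound_le (n₀ : ℕ) {c : ℝ} (hc : 0 < c) :
    ∀ᶠ X : ℝ in atTop,
      (n₀ : ℝ) * Real.log ((n₀ : ℝ) + 2) ^ 2 +
        2 * (((Nat.sqrt (⌊X⌋₊ + 2) + 1) * (Nat.log 2 (⌊X⌋₊ + 2) + 1) : ℕ) : ℝ) *
          Real.log (((⌊X⌋₊ : ℕ) : ℝ) + 2) ^ 2 ≤ c * X := by
  set K₀ : ℝ := (n₀ : ℝ) * Real.log ((n₀ : ℝ) + 2) ^ 2 with hK₀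
  have hK₀0 : 0 ≤ K₀ := by positivity
  -- `(log Y)^3 ≤ (c/48) √Y` for large `Y`
  have hlo := (isLittleO_log_rpow_rpow_atTop (3 : ℝ) (by norm_num : (0 : ℝ) < 1 / 2)).bound
    (by positivity : (0 : ℝ) < c / 48)
  obtain ⟨Y₁, hY₁⟩ := eventually_atTop.mp hlo
  -- thresholds
  filter_upwards [eventually_ge_atTop Y₁, eventually_ge_atTop (Real.exp 1),
    eventually_ge_atTop (4 * K₀ / c), eventually_ge_atTop (2 : ℝ)] with X hXY₁ hXe hXK hX2
  set N : ℕ := ⌊X⌋₊ with hN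
  set Y : ℝ := ((N : ℕ) : ℝ) + 2 with hY
  have hNX : (N : ℝ) ≤ X := Nat.floor_le (by linarith)
  have hXN : X < (N : ℝ) + 1 := Nat.lt_floor_add_one X
  have hYX : X ≤ Y := by rw [hY]; linarith
  have hY2X : Y ≤ 2 * X := by rw [hY]; linarith
  have hYpos : 0 < Y := by linarith
  have hYe : Real.exp 1 ≤ Y := hXe.trans hYX
  have hlogY1 : 1 ≤ Real.log Y := by
    rw [← Real.log_exp 1]; exact Real.log_le_log (Real.exp_pos 1) hYe
  have hlogY0 : 0 ≤ Real.log Y := by linarith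
  have hsqrtY1 : 1 ≤ Real.sqrt Y := by
    rw [← Real.sqrt_one]; exact Real.sqrt_le_sqrt (by linarith [Real.add_one_le_exp (1 : ℝ)])
  -- the integer quantities against `√Y` and `log Y`
  have hcastY : (((N + 2 : ℕ)) : ℝ) = Y := by rw [hY]; push_cast; ring
  have hsqrt : ((Nat.sqrt (N + 2) : ℕ) : ℝ) ≤ Real.sqrt Y := by
    rw [← hcastY]; exact Real.nat_sqrt_le_real_sqrt
  have hlog2 : ((Nat.log 2 (N + 2) : ℕ) : ℝ) ≤ 2 * Real.log Y := by
    have h1 : ((Nat.log 2 (N + 2) : ℕ) : ℝ) ≤ Real.logb 2 (N + 2 : ℕ) := Real.natLog_le_logb _ _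
    rw [hcastY, Real.logb] at h1
    have hl2 : (1 / 2 : ℝ) < Real.log 2 := by
      have := Real.log_two_gt_d9; linarith
    have h1' : ((Nat.log 2 (N + 2) : ℕ) : ℝ) * Real.log 2 ≤ Real.log Y :=
      (le_div_iff₀ (by linarith)).mp h1
    have ha0 : (0 : ℝ) ≤ ((Nat.log 2 (N + 2) : ℕ) : ℝ) := Nat.cast_nonneg _
    nlinarith
  have hprod : (((Nat.sqrt (N + 2) + 1) * (Nat.log 2 (N + 2) + 1) : ℕ) : ℝ) ≤
      6 * Real.sqrt Y * Real.log Y := by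
    push_cast
    have ha : ((Nat.sqrt (N + 2) : ℕ) : ℝ) + 1 ≤ 2 * Real.sqrt Y := by linarith
    have hb : ((Nat.log 2 (N + 2) : ℕ) : ℝ) + 1 ≤ 3 * Real.log Y := by linarith
    have ha0 : 0 ≤ ((Nat.sqrt (N + 2) : ℕ) : ℝ) + 1 := by positivity
    have hb0 : 0 ≤ ((Nat.log 2 (N + 2) : ℕ) : ℝ) + 1 := by positivity
    calc (((Nat.sqrt (N + 2) : ℕ) : ℝ) + 1) * (((Nat.log 2 (N + 2) : ℕ) : ℝ) + 1)
        ≤ (2 * Real.sqrt Y) * (3 * Real.log Y) := mul_le_mul ha hb hb0 (by positivity)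
      _ = 6 * Real.sqrt Y * Real.log Y := by ring
  -- `(log Y)^3 ≤ (c/48) √Y`
  have hl3 : Real.log Y ^ 3 ≤ c / 48 * Real.sqrt Y := by
    have h := hY₁ Y (hXY₁.trans hYX)
    rw [Real.norm_eq_abs, Real.norm_eq_abs, abs_of_nonneg (Real.rpow_nonneg hlogY0 _),
      abs_of_nonneg (Real.rpow_nonneg hYpos.le _), ← Real.sqrt_eq_rpow,
      show (3 : ℝ) = ((3 : ℕ) : ℝ) by norm_num, Real.rpow_natCast] at h
    exact h
  have hmain : 2 * (6 * Real.sqrt Y * Real.log Y) * Real.log Y ^ 2 ≤ c / 4 * Y := by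
    have hsq : Real.sqrt Y * Real.sqrt Y = Y := Real.mul_self_sqrt hYpos.le
    calc 2 * (6 * Real.sqrt Y * Real.log Y) * Real.log Y ^ 2
        = 12 * Real.sqrt Y * Real.log Y ^ 3 := by ring
      _ ≤ 12 * Real.sqrt Y * (c / 48 * Real.sqrt Y) := by gcongr
      _ = c / 4 * (Real.sqrt Y * Real.sqrt Y) := by ring
      _ = c / 4 * Y := by rw [hsq]
  have hK : K₀ ≤ c / 4 * Y := by
    have : 4 * K₀ / c ≤ Y := hXK.trans hYX
    rw [div_le_iff₀ hc] at this
    linarith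
  have hlogYsq : 0 ≤ Real.log Y ^ 2 := sq_nonneg _
  calc K₀ + 2 * (((Nat.sqrt (N + 2) + 1) * (Nat.log 2 (N + 2) + 1) : ℕ) : ℝ) * Real.log Y ^ 2
      ≤ K₀ + 2 * (6 * Real.sqrt Y * Real.log Y) * Real.log Y ^ 2 := by
        gcongr
    _ ≤ c / 4 * Y + c / 4 * Y := add_le_add hK hmain
    _ ≤ c * X := by nlinarith

/-- If the twin prime conjecture FAILS, the Hardy–Littlewood pair asymptotic for the shift `2`
fails robustly: eventually `|∑_{n ≤ X} Λ(n)Λ(n+2) - 𝔖_2 X| ≥ C₂ X` (`𝔖_2 = 2C₂ > 0`, tree: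
`Literature.NumberTheory.Sieve.twinPrimeConst_pos_holds`), the sum being `o(X)` (twin primes below a fixed bound and
higher prime powers only, `Literature.NumberTheory.Sieve.card_higherPrimePowers_le`). [folklore] -/
theorem robustHLFailure_of_not_twinPrime (hno : ¬ Literature.NumberTheory.Sieve.TwinPrimeConjecture) :
    ∀ᶠ X : ℝ in atTop,
      Literature.NumberTheory.Sieve.twinPrimeConst * X ≤ |(∑ n ∈ Icc 1 ⌊X⌋₊, Λ n * Λ (n + 2)) - X * Literature.NumberTheory.Sieve.goldbachSingularSeries 2| := by
  unfold Literature.NumberTheory.Sieve.TwinPrimeConjecture at hno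
  simp only [not_forall, not_exists, not_and] at hno
  obtain ⟨n₀, hn₀⟩ := hno
  have hno' : ∀ p : ℕ, n₀ < p → ¬ (p.Prime ∧ (p + 2).Prime) := fun p hp h => hn₀ p hp h.1 h.2
  have hC := Literature.NumberTheory.Sieve.twinPrimeConst_pos_holds
  filter_upwards [eventually_pairSumBound_le n₀ hC, eventually_ge_atTop (0 : ℝ)] with X hX hX0
  have hS := (pairSum_le_of_noTwinAbove hno' ⌊X⌋₊).trans hX
  rw [goldbachSingularSeries_two]
  have : X * (2 * Literature.NumberTheory.Sieve.twinPrimeConst) - ∑ n ∈ Icc 1 ⌊X⌋₊, Λ n * Λ (n + 2) ≥ Literature.NumberTheory.Sieve.twinPrimeConst * X := by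
    nlinarith
  rw [abs_sub_comm]
  exact this.le.trans (le_abs_self _)


/-! ### Proof of the record modulo Matomäki–Merikoski -/

/-- **A robust failure of the pair asymptotic bounds Siegel zeros** (proved from the tree's
Matomäki–Merikoski fact): if for one shift `h ≥ 1`, `|∑_{n ≤ X} Λ(n)Λ(n+h) - 𝔖_h X| ≥ cX`,
`c > 0`, for all large `X`, then Siegel zeros of quality `η ≥ η₀` do not occur at conductors
`q ≥ q₀` (take `X = q^{10}` in the window `[q^{10}, q^{10 log η}]`, `C = 1`).
[cite: MatomakiMerikoski2023, Corollary 1.1(i)] -/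
theorem robustHLFailure_eliminates (hMM : MatomakiMerikoski2023_fixedShift) {h : ℕ} (hh : 1 ≤ h)
    {c : ℝ} (hc : 0 < c)
    (hfail : ∀ᶠ X : ℝ in atTop,
      c * X ≤ |(∑ n ∈ Icc 1 ⌊X⌋₊, Λ n * Λ (n + h)) - X * Literature.NumberTheory.Sieve.goldbachSingularSeries h|) :
    ∃ η₀ : ℝ, ∃ q₀ : ℕ, ∀ (q : ℕ) [NeZero q] (χ : DirichletCharacter ℂ q) (η : ℝ),
      q₀ ≤ q → IsSiegelZero χ η → η < η₀ := by
  obtain ⟨K, hK, hMM'⟩ := hMM h hh 1 le_rfl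
  -- `K e^{-√log η} < c` for large `η`
  have hlim : Tendsto (fun η : ℝ => K * Real.exp (-1 * Real.sqrt (Real.log η))) atTop (𝓝 0) := by
    have h1 : Tendsto (fun η : ℝ => Real.exp (-1 * Real.sqrt (Real.log η))) atTop (𝓝 0) := by
      refine Real.tendsto_exp_atBot.comp ?_
      have : Tendsto (fun η : ℝ => Real.sqrt (Real.log η)) atTop atTop :=
        (Real.tendsto_sqrt_atTop).comp Real.tendsto_log_atTop
      simpa using this.const_mul_atTop_of_neg (by norm_num : (-1 : ℝ) < 0)
    simpa using h1.const_mul K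
  obtain ⟨η₀, hη₀⟩ := eventually_atTop.mp (hlim.eventually (gt_mem_nhds hc))
  obtain ⟨X₁, hX₁⟩ := eventually_atTop.mp hfail
  refine ⟨η₀, max ⌈X₁⌉₊ 2, fun q _ χ η hq hS => ?_⟩
  by_contra hη
  rw [not_lt] at hη
  obtain ⟨hprim, hquad, hη10, hL⟩ := hS
  have hq2 : 2 ≤ q := le_of_max_le_right hq
  have hq1' : (1 : ℝ) ≤ q := by exact_mod_cast (show 1 ≤ q by omega)
  set X : ℝ := (q : ℝ) ^ (10 : ℝ) with hX
  have hXq : (q : ℝ) ≤ X := by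
    calc (q : ℝ) = (q : ℝ) ^ (1 : ℝ) := (Real.rpow_one _).symm
      _ ≤ X := Real.rpow_le_rpow_of_exponent_le hq1' (by norm_num)
  have hX₁X : X₁ ≤ X := by
    have : (⌈X₁⌉₊ : ℝ) ≤ q := by exact_mod_cast le_of_max_le_left hq
    exact (Nat.le_ceil X₁).trans (this.trans hXq)
  have hXpos : 0 < X := by positivity
  have hlogη : 1 ≤ Real.log η := by
    rw [← Real.log_exp 1]
    exact Real.log_le_log (Real.exp_pos 1)
      (by linarith [Real.exp_one_lt_d9.le.trans (by norm_num : (2.7182818286 : ℝ) ≤ 10)])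
  have hXup : X ≤ (q : ℝ) ^ (10 * Real.log η) :=
    Real.rpow_le_rpow_of_exponent_le hq1' (by nlinarith)
  have h1 := hMM' q hq2 χ hprim hquad η hη10 hL X le_rfl hXup
  have h2 := hX₁ X hX₁X
  have h3 := hη₀ η hη
  have h4 : K * X * Real.exp (-1 * Real.sqrt (Real.log η)) < c * X := by
    have := mul_lt_mul_of_pos_right h3 hXpos
    linarith [this]
  linarith

/-- **Heath-Brown's dichotomy, proved modulo Matomäki–Merikoski**: Siegel zeros of unbounded
quality at arbitrarily large conductors imply the twin prime conjecture. (If twin primes were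
finite, `robustHLFailure_of_not_twinPrime` and `robustHLFailure_eliminates` with `h = 2` would
bound the quality.) [cite: MatomakiMerikoski2023, Corollary 1.1(i)] [cite: TaoTeravainen2021, Theorem 1.5 (i)] -/
theorem SiegelZeroTwinPrimes_of_matomakiMerikoski (hMM : MatomakiMerikoski2023_fixedShift) :
    SiegelZeroTwinPrimes := by
  intro hSZ
  by_contra hno
  obtain ⟨η₀, q₀, hb⟩ :=
    robustHLFailure_eliminates hMM (h := 2) (by norm_num) Literature.NumberTheory.Sieve.twinPrimeConst_pos_holds
      (robustHLFailure_of_not_twinPrime hno)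
  obtain ⟨q, inst, χ, η, hq, hη, hS⟩ := hSZ η₀ q₀
  exact absurd (hb q χ η hq hS) (not_lt.mpr hη)

/-- The no-go for disproofs, unconditionally modulo the tree's Matomäki–Merikoski fact.
[cite: MatomakiMerikoski2023, Corollary 1.1(i)] -/
theorem not_twinPrime_bounds_siegelZeros (hMM : MatomakiMerikoski2023_fixedShift)
    (hno : ¬ Literature.NumberTheory.Sieve.TwinPrimeConjecture) :
    ∃ η₀ : ℝ, ∃ q₀ : ℕ, ∀ (q : ℕ) [NeZero q] (χ : DirichletCharacter ℂ q) (η : ℝ),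
      q₀ ≤ q → IsSiegelZero χ η → η < η₀ :=
  (SiegelZeroTwinPrimes_of_matomakiMerikoski hMM).disproof_bounds_quality hno

/-! ### The Liouville side (Tao–Teräväinen 2022, Corollary 1.8 (ii)) -/

/-- `𝔼_{n ≤ x} ∏_{h ∈ H} λ(n + h)` for a finite set `H` of shifts (average over `1 ≤ n ≤ x`,
`λ` = Mathlib's `ArithmeticFunction.liouville`). [cite: TaoTeravainen2021, Conjecture 1.1] -/
def liouvilleTupleAverage (H : Finset ℕ) (x : ℕ) : ℝ :=
  (∑ n ∈ Icc 1 x, ∏ h ∈ H, (ArithmeticFunction.liouville (n + h) : ℝ)) / x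

/-- **Bridge to the tree's Chowla object**: for an injective tuple `h : Fin k → ℕ`,
`∑_{n < x+1} ∏ᵢ λ(n + hᵢ)` (`Literature.Parity.liouvilleCorrelation h (x + 1)`) is the `n = 0` term plus
`x · 𝔼_{1 ≤ n ≤ x} ∏_{h ∈ im h} λ(n + h)`. [folklore] -/
theorem liouvilleCorrelation_succ_eq {k : ℕ} {h : Fin k → ℕ} (hinj : Function.Injective h)
    {x : ℕ} (hx : 1 ≤ x) :
    (Literature.NumberTheory.Sieve.liouvilleCorrelation h (x + 1) : ℝ) =
      (∏ i, (ArithmeticFunction.liouville (h i) : ℝ)) +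
        x * liouvilleTupleAverage (Finset.univ.image h) x := by
  have hx0 : (x : ℝ) ≠ 0 := by exact_mod_cast (show x ≠ 0 by omega)
  unfold liouvilleTupleAverage Literature.NumberTheory.Sieve.liouvilleCorrelation
  rw [mul_div_cancel₀ _ hx0]
  push_cast
  have hprod : ∀ n : ℕ, ∏ h' ∈ Finset.univ.image h, (ArithmeticFunction.liouville (n + h') : ℝ) =
      ∏ i, (ArithmeticFunction.liouville (n + h i) : ℝ) := fun n =>
    Finset.prod_image fun i _ j _ hij => hinj hij
  simp_rw [hprod]
  have hIcc : Finset.Icc 1 x = (Finset.range x).image (· + 1) := by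
    ext n
    simp only [Finset.mem_Icc, Finset.mem_image, Finset.mem_range]
    constructor
    · intro hn
      exact ⟨n - 1, by omega, by omega⟩
    · rintro ⟨m, hm, rfl⟩
      omega
  rw [Finset.sum_range_succ', hIcc, Finset.sum_image fun a _ b _ hab => by simpa using hab]
  simp only [zero_add]
  rw [add_comm]

/-- **Tao–Teräväinen 2022, Corollary 1.8 (ii)** (Chowla's conjecture on the scales attached to an
exceptional zero, as printed): for distinct fixed natural numbers `h'₁, …, h'_ℓ` (`ℓ ≥ 1`,
shifts `≥ 1`) and fixed `0 < ε₀ < 1` there is `C` (ineffective, depending on the shifts and `ε₀`)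
such that for every Siegel zero of quality `η` attached to the conductor `q`,
`|𝔼_{n ≤ x} λ(n+h'₁)⋯λ(n+h'_ℓ)| ≤ C / log^{1/10} η` for all `q^{1/2+ε₀} ≤ x ≤ q^{η^{1/2}}`.
A NAMED FACT. [cite: TaoTeravainen2021, Corollary 1.8 (ii) and §2.1] -/
def TaoTeravainen2021_chowla : Prop :=
  ∀ H : Finset ℕ, H.Nonempty → (∀ h ∈ H, 1 ≤ h) → ∀ ε₀ : ℝ, 0 < ε₀ → ε₀ < 1 →
    ∃ C : ℝ, ∀ (q : ℕ) [NeZero q] (χ : DirichletCharacter ℂ q) (η : ℝ), IsSiegelZero χ η →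
      ∀ x : ℕ, (q : ℝ) ^ ((1 : ℝ) / 2 + ε₀) ≤ x → (x : ℝ) ≤ (q : ℝ) ^ Real.sqrt η →
        |liouvilleTupleAverage H x| ≤ C / Real.log η ^ ((1 : ℝ) / 10)

/-- **No-go (Liouville side)**: if Chowla's conjecture `Literature.NumberTheory.Sieve.ChowlaConjecture` fails
ROBUSTLY for one injective tuple `h` of shifts `≥ 1` — `|∑_{n < x} ∏ᵢ λ(n + hᵢ)| ≥ cx`, `c > 0`,
for all large `x` — then Siegel zeros of quality `η ≥ η₀` do not occur at conductors `q ≥ q₀`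
(take `x = q` in the window with `ε₀ = 1/4` and use the bridge at `q + 1`).
[cite: TaoTeravainen2021, Corollary 1.8 (ii)] -/
theorem robustChowlaFailure_eliminates (hT : TaoTeravainen2021_chowla) {k : ℕ} (hk : 0 < k)
    {h : Fin k → ℕ} (hinj : Function.Injective h) (hh : ∀ i, 1 ≤ h i) {c : ℝ} (hc : 0 < c)
    (hfail : ∀ᶠ x : ℕ in atTop, c * x ≤ |(Literature.NumberTheory.Sieve.liouvilleCorrelation h x : ℝ)|) :
    ∃ η₀ : ℝ, ∃ q₀ : ℕ, ∀ (q : ℕ) [NeZero q] (χ : DirichletCharacter ℂ q) (η : ℝ),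
      q₀ ≤ q → IsSiegelZero χ η → η < η₀ := by
  classical
  set H : Finset ℕ := Finset.univ.image h with hH
  have hHne : H.Nonempty := by
    rw [hH, Finset.image_nonempty]
    exact Finset.univ_nonempty_iff.mpr ⟨⟨0, hk⟩⟩
  have hH1 : ∀ h' ∈ H, 1 ≤ h' := by
    intro h' hh'
    rw [hH, Finset.mem_image] at hh'
    obtain ⟨i, -, rfl⟩ := hh'
    exact hh i
  obtain ⟨C, hC⟩ := hT H hHne hH1 (1 / 4) (by norm_num) (by norm_num)
  have hlim : Tendsto (fun η : ℝ => C / Real.log η ^ ((1 : ℝ) / 10)) atTop (𝓝 0) :=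
    tendsto_const_nhds.div_atTop
      ((tendsto_rpow_atTop (by norm_num)).comp Real.tendsto_log_atTop)
  obtain ⟨η₀, hη₀⟩ := eventually_atTop.mp (hlim.eventually (gt_mem_nhds (half_pos hc)))
  obtain ⟨x₁, hx₁⟩ := eventually_atTop.mp hfail
  refine ⟨η₀, max x₁ (max 1 (⌈4 / c⌉₊)), fun q _ χ η hq hS => ?_⟩
  by_contra hη
  rw [not_lt] at hη
  have hqx₁ : x₁ ≤ q := le_of_max_le_left hq
  have hq1 : 1 ≤ q := le_of_max_le_left (le_of_max_le_right hq)
  have hq4 : ⌈4 / c⌉₊ ≤ q := le_of_max_le_right (le_of_max_le_right hq)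
  have hq1' : (1 : ℝ) ≤ q := by exact_mod_cast hq1
  have hq4' : 4 / c ≤ q := (Nat.le_ceil _).trans (by exact_mod_cast hq4)
  have hη10 : 10 ≤ η := hS.ten_le
  -- `x = q` lies in the window
  have hlow : (q : ℝ) ^ ((1 : ℝ) / 2 + 1 / 4) ≤ (q : ℕ) := by
    calc (q : ℝ) ^ ((1 : ℝ) / 2 + 1 / 4) ≤ (q : ℝ) ^ (1 : ℝ) :=
          Real.rpow_le_rpow_of_exponent_le hq1' (by norm_num)
      _ = q := Real.rpow_one _
  have hup : ((q : ℕ) : ℝ) ≤ (q : ℝ) ^ Real.sqrt η := by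
    calc ((q : ℕ) : ℝ) = (q : ℝ) ^ (1 : ℝ) := (Real.rpow_one _).symm
      _ ≤ (q : ℝ) ^ Real.sqrt η := by
          refine Real.rpow_le_rpow_of_exponent_le hq1' ?_
          rw [show (1 : ℝ) = Real.sqrt 1 from Real.sqrt_one.symm]
          exact Real.sqrt_le_sqrt (by linarith)
  have havg : |liouvilleTupleAverage H q| ≤ C / Real.log η ^ ((1 : ℝ) / 10) := hC q χ η hS q hlow hup
  have hsmall : C / Real.log η ^ ((1 : ℝ) / 10) < c / 2 := hη₀ η hη
  -- the bridge at `q + 1`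
  have hbr := liouvilleCorrelation_succ_eq hinj hq1
  rw [← hH] at hbr
  have hP : |∏ i, (ArithmeticFunction.liouville (h i) : ℝ)| ≤ 1 := by
    rw [Finset.abs_prod]
    calc ∏ i, |(ArithmeticFunction.liouville (h i) : ℝ)| ≤ ∏ _i : Fin k, (1 : ℝ) :=
          Finset.prod_le_prod (fun i _ => abs_nonneg _) fun i _ => Literature.NumberTheory.Sieve.abs_liouville_le_one _
      _ = 1 := by simp
  have hcorr := hx₁ (q + 1) (by omega)
  rw [hbr] at hcorr
  have hq0 : (0 : ℝ) ≤ q := by positivity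
  have habs : |(∏ i, (ArithmeticFunction.liouville (h i) : ℝ)) + q * liouvilleTupleAverage H q| ≤
      1 + q * (C / Real.log η ^ ((1 : ℝ) / 10)) := by
    calc _ ≤ |∏ i, (ArithmeticFunction.liouville (h i) : ℝ)| + |(q : ℝ) * liouvilleTupleAverage H q| :=
          abs_add_le _ _
      _ ≤ 1 + q * (C / Real.log η ^ ((1 : ℝ) / 10)) := by
          rw [abs_mul, abs_of_nonneg hq0]
          exact add_le_add hP (mul_le_mul_of_nonneg_left havg hq0)
  have h5 : (q : ℝ) * (C / Real.log η ^ ((1 : ℝ) / 10)) ≤ q * (c / 2) :=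
    mul_le_mul_of_nonneg_left hsmall.le hq0
  push_cast at hcorr
  have hc0 : c ≠ 0 := hc.ne'
  have h6 : (4 : ℝ) ≤ c * q := by
    calc (4 : ℝ) = c * (4 / c) := by field_simp
      _ ≤ c * q := mul_le_mul_of_nonneg_left hq4' hc.le
  linarith

end Literature.Barriers.Parity
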